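import Summits.MatrixMultiplication.MatrixMultiplication.Theorems.ObstructionDescentCountingEquations
import Literature.Computability.AlgebraicComplexity.UnitTensorMomentPolytopeProofs

/-!
# Overshoot fails at row two: degree-`m²` equations of `σ_m` separate `σ_m` from tensors of rank `n^{2+δ}`
(decomp-mm · lens 3 · gen 24 kernel; route-independent module: imports no `Theses` file)

Route `route-MatrixMultiplication-ObstructionDescent` (`ω(ℂ) = 2`), degree axis `E = NoPolyDegreeObstruction`
(item `stmt-MatrixMultiplication-30889`, IDEA-NEEDED at its first open row `c = 2`): at every cell `n^τ ≤ m` (`τ > 2`) every equation of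
`σ_m((ℂ^{n×n})^{⊗3})` of degree `≤ m^c` vanishes at `⟨n,n,n⟩`.  The one MM-free mechanism that could give a row of `E` from what is
KNOWN about `⟨n,n,n⟩` — its border rank `≤ n^{ω+ε}` — is an OVERSHOOT LAW: «the equations of `σ_m` of degree `≤ m^c` vanish on the much
larger secant variety `σ_M`, `M = n^{2+δ}`» (cell memo NODE-g22 §3, law `OS`; expected false there, undecided).  This module DECIDES it at
row two, in the tree's language and for every format:
* §1 **sub-format transport**: an equation of `σ_r(ℂ^{α'} ⊗ ℂ^β ⊗ ℂ^γ)`, re-indexed along an injection `ι : α' ↪ α`, is an equation of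
  `σ_r(ℂ^α ⊗ ℂ^β ⊗ ℂ^γ)` (restriction does not raise rank, Bläser Lemma 5.4 = `tensorRank_precomp_le`), stays non-zero, and is non-zero
  at the zero-extension of a sub-format point — a tensor of rank `≤ |α'|·|β|`; with Kumar–Volk counting
  (`ObstructionDescentCountingEquations.exists_mem_RV_ne_zero_of_choose_lt`) in the SUB-format this yields equations of `σ_r` that are
  non-zero somewhere on `σ_{|α'|·|β|}` (`exists_separating_of_subformat`);
* §2 the arithmetic of one explicit family (`k^D ≤ C(D·k, D)` by graphs of functions; the room inequality);
* §3 **the family**: for `t ≥ 2`, `k ≥ 12t + 10`, at the corner cell `n = k^t`, `m = k^{2t+1} = n^{2+1/t}` there is an equation of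
  `σ_m((ℂ^{n×n})^{⊗3})`, homogeneous of degree `m² = k^{4t+2}`, NON-ZERO at a tensor of rank `≤ k^{2t+3} = n^{2+3/t}`
  (`overshoot_family`); hence for every `δ > 0` there is `τ > 2` with infinitely many cells `n^τ ≤ m` at which
  `I(σ_m)_{m²} ⊄ I(σ_{n^{2+δ}})` (`overshoot_fails_rowTwo`, the statement of the route aside `OvershootFailsRowTwo`).
Reading for `E`: at row `2` no bound `bR(⟨n,n,n⟩) ≤ n^{2+δ}` with `δ > 0` FIXED yields `E` through ideal containment; a proof of
row `2` must use the point `⟨n,n,n⟩`, not only the secant variety it lies on.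
No proposition is defined; sorry-free; standard axioms.  Nothing here proves `ω = 2`.
[cite: KumarVolk2022, Theorem 10 (arXiv:2003.12938 p. 7); Blaser2013, §4 + Lemma 5.4; LandsbergGCT2017, §8.3.4 (p. 227)]
-/

set_option linter.dupNamespace false
set_option autoImplicit false

noncomputable section

open scoped BigOperators
open Finset

namespace Summit.MatrixMultiplication.MatrixMultiplication.Theorems.ObstructionDescentOvershoot

open Literature.Computability.AlgebraicComplexity (triad triad_apply tensorRank tensorRank_precomp_le tensorRank_le_of_eq_sum
  exists_triad_decomposition_tensorRank tensorRank_le_card_mul_card₁₂)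
open Summit.MatrixMultiplication.MatrixMultiplication.Theorems.ObstructionDescentTorusLaws (RV mem_RV)
open Summit.MatrixMultiplication.MatrixMultiplication.Theorems.ObstructionDescentCountingEquations
  (exists_mem_RV_ne_zero_of_choose_lt)

/-! ## §1 Sub-format transport: equations of `σ_r` in `α' × β × γ` are equations of `σ_r` in `α × β × γ` -/

section Subformat

variable {α α' β γ : Type} [Fintype α] [Fintype α'] [Fintype β] [Fintype γ]
  [DecidableEq α] [DecidableEq α'] [DecidableEq β] [DecidableEq γ]

/-- The index map of the sub-format inclusion along `ι : α' → α` on the first factor. [bookkeeping] -/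
def idxMap (ι : α' → α) : α' × β × γ → α × β × γ := fun p => (ι p.1, p.2)

omit [Fintype α] [Fintype α'] [Fintype β] [Fintype γ] [DecidableEq α] [DecidableEq α'] [DecidableEq β] [DecidableEq γ] in
/-- The index map of an injective `ι` is injective. [bookkeeping] -/
theorem idxMap_injective {ι : α' → α} (hι : Function.Injective ι) :
    Function.Injective (idxMap (β := β) (γ := γ) ι) := by
  rintro ⟨a, q⟩ ⟨a', q'⟩ h
  simp only [idxMap, Prod.mk.injEq] at h
  rw [hι h.1, h.2]

omit [DecidableEq α] [DecidableEq α'] [DecidableEq β] [DecidableEq γ] in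
/-- **Re-indexed sub-format equations are equations** (restriction along `ι` does not raise rank, Bläser Lemma 5.4).
[cite: Blaser2013, Lemma 5.4] -/
theorem rename_mem_RV {ι : α' → α} {r : ℕ} {f : MvPolynomial (α' × β × γ) ℂ} (hf : f ∈ RV α' β γ r) :
    MvPolynomial.rename (idxMap ι) f ∈ RV α β γ r := by
  refine mem_RV.2 fun t ht => ?_
  have hrk : tensorRank (fun a' b c => t (ι a') b c) ≤ r := (tensorRank_precomp_le t ι id id).trans ht
  have key := mem_RV.1 hf _ hrk
  rw [MvPolynomial.aeval_rename]
  exact key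

/-- Zero-extension of a sub-format tensor along `ι` on the first factor. [bookkeeping] -/
def extendTensor (ι : α' → α) (s : α' → β → γ → ℂ) : α → β → γ → ℂ :=
  fun a b c => Function.extend ι (fun a' => s a' b c) 0 a

omit [Fintype α] [Fintype α'] [Fintype β] [Fintype γ] [DecidableEq α] [DecidableEq α'] [DecidableEq β] [DecidableEq γ] in
/-- On the image of `ι` the extension is the original tensor. [bookkeeping] -/
theorem extendTensor_apply {ι : α' → α} (hι : Function.Injective ι) (s : α' → β → γ → ℂ) (a' : α') (b : β) (c : γ) :
    extendTensor ι s (ι a') b c = s a' b c :=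
  hι.extend_apply _ _ _

omit [Fintype α] [Fintype α'] [Fintype β] [Fintype γ] [DecidableEq α] [DecidableEq α'] [DecidableEq β] [DecidableEq γ] in
/-- Off the image of `ι` the extension vanishes. [bookkeeping] -/
theorem extendTensor_apply_of_not {ι : α' → α} (s : α' → β → γ → ℂ) {a : α} (ha : ¬∃ a', ι a' = a) (b : β) (c : γ) :
    extendTensor ι s a b c = 0 := by
  simp [extendTensor, Function.extend_apply' _ _ _ ha]

omit [Fintype α] [DecidableEq α] [DecidableEq α'] [DecidableEq β] [DecidableEq γ] in
/-- **Zero-extension does not raise rank** (extend each first vector of a triad decomposition by zero). [cite: Blaser2013, §4] -/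
theorem tensorRank_extendTensor_le {ι : α' → α} (hι : Function.Injective ι) (s : α' → β → γ → ℂ) :
    tensorRank (extendTensor ι s) ≤ tensorRank s := by
  classical
  obtain ⟨w, u, v, e⟩ := exists_triad_decomposition_tensorRank s
  refine tensorRank_le_of_eq_sum (fun i => Function.extend ι (w i) 0) u v ?_
  funext a b c
  rw [Finset.sum_apply, Finset.sum_apply, Finset.sum_apply]
  simp only [triad_apply]
  by_cases ha : ∃ a', ι a' = a
  · obtain ⟨a', rfl⟩ := ha
    rw [extendTensor_apply hι]
    have hs : s a' b c = (∑ i, triad (w i) (u i) (v i)) a' b c := by rw [← e]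
    rw [hs, Finset.sum_apply, Finset.sum_apply, Finset.sum_apply]
    simp only [triad_apply, hι.extend_apply]
  · rw [extendTensor_apply_of_not s ha]
    symm
    refine Finset.sum_eq_zero fun i _ => ?_
    rw [Function.extend_apply' _ _ _ ha, Pi.zero_apply, zero_mul, zero_mul]

omit [Fintype α] [Fintype α'] [Fintype β] [Fintype γ] [DecidableEq α] [DecidableEq α'] [DecidableEq β] [DecidableEq γ] in
/-- A non-zero complex polynomial is non-zero at some point (`ℂ` is infinite). [folklore] -/
theorem exists_aeval_ne_zero {σ : Type} {f : MvPolynomial σ ℂ} (hf : f ≠ 0) :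
    ∃ x : σ → ℂ, MvPolynomial.aeval x f ≠ 0 := by
  by_contra h
  push Not at h
  refine hf (MvPolynomial.funext fun x => ?_)
  rw [map_zero]
  exact h x

omit [DecidableEq α] in
/-- **Separating equations from a sub-format**: if Kumar–Volk's room inequality holds in the SUB-format `α' × β × γ` then
`σ_r(ℂ^α ⊗ ℂ^β ⊗ ℂ^γ)` has a non-zero equation, homogeneous of degree `D`, that is NON-ZERO at some tensor of rank `≤ |α'|·|β|`
(a tensor supported on the `|α'|` slices `ι(α')`). [cite: KumarVolk2022, Theorem 10 (arXiv:2003.12938 p. 7); Blaser2013, §4 + Lemma 5.4] -/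
theorem exists_separating_of_subformat {ι : α' → α} (hι : Function.Injective ι) (r D : ℕ)
    (h : (3 * D + 1) ^ Fintype.card ((Fin r × α') ⊕ ((Fin r × β) ⊕ (Fin r × γ))) < (Fintype.card (α' × β × γ)).choose D) :
    ∃ F ∈ RV α β γ r, F ≠ 0 ∧ F.IsHomogeneous D ∧
      ∃ T : α → β → γ → ℂ, tensorRank T ≤ Fintype.card α' * Fintype.card β ∧
        MvPolynomial.aeval (fun q : α × β × γ => T q.1 q.2.1 q.2.2) F ≠ 0 := by
  classical
  obtain ⟨f, hf, hf0, hhom⟩ := exists_mem_RV_ne_zero_of_choose_lt (α := α') (β := β) (γ := γ) r D h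
  obtain ⟨x, hx⟩ := exists_aeval_ne_zero hf0
  let s : α' → β → γ → ℂ := fun a' b c => x (a', b, c)
  refine ⟨MvPolynomial.rename (idxMap ι) f, rename_mem_RV hf, ?_, hhom.rename_isHomogeneous, extendTensor ι s, ?_, ?_⟩
  · intro h0
    refine hf0 (MvPolynomial.rename_injective _ (idxMap_injective hι) ?_)
    rw [h0, map_zero]
  · exact (tensorRank_extendTensor_le hι s).trans (tensorRank_le_card_mul_card₁₂ s)
  · rw [MvPolynomial.aeval_rename]
    have hfun : ((fun q : α × β × γ => extendTensor ι s q.1 q.2.1 q.2.2) ∘ idxMap ι) = x := by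
      funext p
      simp only [Function.comp_apply, idxMap, extendTensor_apply hι, s]
    rwa [hfun]

end Subformat

/-! ## §2 Arithmetic of the explicit family -/

section Arithmetic

/-- `k^D ≤ C(D·k, D)`: graphs of the functions `[D] → [k]` are distinct `D`-subsets of `[D] × [k]`. [folklore] -/
theorem pow_le_choose_mul (D k : ℕ) : k ^ D ≤ (D * k).choose D := by
  classical
  let G : (Fin D → Fin k) → Finset (Fin D × Fin k) := fun φ => Finset.univ.image fun i => (i, φ i)
  have hG : Function.Injective G := by
    intro φ ψ h
    funext i
    have hi : (i, φ i) ∈ G ψ := by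
      rw [← h]; exact Finset.mem_image.2 ⟨i, Finset.mem_univ _, rfl⟩
    obtain ⟨j, _, hj⟩ := Finset.mem_image.1 hi
    simp only [Prod.mk.injEq] at hj
    rw [← hj.2, hj.1]
  have hmem : ∀ φ, G φ ∈ (Finset.univ : Finset (Fin D × Fin k)).powersetCard D := fun φ => by
    refine Finset.mem_powersetCard.2 ⟨Finset.subset_univ _, ?_⟩
    rw [Finset.card_image_of_injective _ (fun i j hij => by simpa using congrArg Prod.fst hij)]
    simp
  have hsub : Finset.univ.image G ⊆ (Finset.univ : Finset (Fin D × Fin k)).powersetCard D := by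
    intro S hS
    obtain ⟨φ, _, rfl⟩ := Finset.mem_image.1 hS
    exact hmem φ
  calc k ^ D = (Finset.univ : Finset (Fin D → Fin k)).card := by simp
    _ = (Finset.univ.image G).card := (Finset.card_image_of_injective _ hG).symm
    _ ≤ ((Finset.univ : Finset (Fin D × Fin k)).powersetCard D).card := Finset.card_le_card hsub
    _ = (D * k).choose D := by simp [Finset.card_powersetCard]

/-- **The room inequality of the family** `K = k³` slices, `n = k^t`, `m = k^{2t+1}`, `D = k^{4t+2}`:
`(3D+1)^{m(K + 2n²)} < C(K·n⁴, D)` for `t ≥ 2`, `k ≥ 12t + 10`. [bookkeeping] -/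
theorem room_family (t k : ℕ) (ht : 2 ≤ t) (hk : 12 * t + 10 ≤ k) :
    (3 * k ^ (4 * t + 2) + 1) ^
        (k ^ (2 * t + 1) * k ^ 3 + (k ^ (2 * t + 1) * (k ^ t * k ^ t) + k ^ (2 * t + 1) * (k ^ t * k ^ t)))
      < (k ^ 3 * ((k ^ t * k ^ t) * (k ^ t * k ^ t))).choose (k ^ (4 * t + 2)) := by
  have hk1 : 1 ≤ k := by omega
  have hbase : 3 * k ^ (4 * t + 2) + 1 ≤ k ^ (4 * t + 3) := by
    have hpow : k ^ (4 * t + 3) = k ^ (4 * t + 2) * k := pow_succ _ _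
    have hpos : 1 ≤ k ^ (4 * t + 2) := Nat.one_le_pow _ _ hk1
    rw [hpow]; nlinarith
  have hexp : k ^ (2 * t + 1) * k ^ 3 + (k ^ (2 * t + 1) * (k ^ t * k ^ t) + k ^ (2 * t + 1) * (k ^ t * k ^ t))
      ≤ 3 * k ^ (4 * t + 1) := by
    have h1 : k ^ (2 * t + 1) * k ^ 3 = k ^ (2 * t + 4) := by rw [← pow_add]
    have h2 : k ^ (2 * t + 1) * (k ^ t * k ^ t) = k ^ (4 * t + 1) := by
      rw [← pow_add, ← pow_add]; congr 1; omega
    have h3 : k ^ (2 * t + 4) ≤ k ^ (4 * t + 1) := Nat.pow_le_pow_right hk1 (by omega)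
    rw [h1, h2]; omega
  have hvars : k ^ 3 * ((k ^ t * k ^ t) * (k ^ t * k ^ t)) = k ^ (4 * t + 2) * k := by
    rw [← pow_add, ← pow_add, ← pow_add, ← pow_succ]; congr 1; omega
  have hstep : (4 * t + 3) * (3 * k ^ (4 * t + 1)) < k ^ (4 * t + 2) := by
    have hpow : k ^ (4 * t + 2) = k ^ (4 * t + 1) * k := pow_succ _ _
    have hpos : 0 < k ^ (4 * t + 1) := by positivity
    rw [hpow]; nlinarith
  calc (3 * k ^ (4 * t + 2) + 1) ^
        (k ^ (2 * t + 1) * k ^ 3 + (k ^ (2 * t + 1) * (k ^ t * k ^ t) + k ^ (2 * t + 1) * (k ^ t * k ^ t)))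
      ≤ (k ^ (4 * t + 3)) ^
        (k ^ (2 * t + 1) * k ^ 3 + (k ^ (2 * t + 1) * (k ^ t * k ^ t) + k ^ (2 * t + 1) * (k ^ t * k ^ t))) :=
          Nat.pow_le_pow_left hbase _
    _ ≤ (k ^ (4 * t + 3)) ^ (3 * k ^ (4 * t + 1)) := Nat.pow_le_pow_right (by positivity) hexp
    _ = k ^ ((4 * t + 3) * (3 * k ^ (4 * t + 1))) := by rw [← pow_mul]
    _ < k ^ (k ^ (4 * t + 2)) := Nat.pow_lt_pow_right (by omega) hstep
    _ ≤ (k ^ (4 * t + 2) * k).choose (k ^ (4 * t + 2)) := pow_le_choose_mul _ _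
    _ = (k ^ 3 * ((k ^ t * k ^ t) * (k ^ t * k ^ t))).choose (k ^ (4 * t + 2)) := by rw [hvars]

end Arithmetic

/-! ## §3 The family at the corner cells of `E`, and the failure of overshoot at row two -/

section Corner

/-- **The explicit family.**  For `t ≥ 2` and `k ≥ 12t+10`, at the corner cell `n = k^t`, `m = k^{2t+1}` (`= n^{2+1/t}`) the secant
variety `σ_m((ℂ^{n×n})^{⊗3})` has a non-zero equation, homogeneous of degree `k^{4t+2} = m²`, that is NON-ZERO at some tensor of rank
`≤ k^{2t+3}` (`= n^{2+3/t}`; a tensor supported on `k³` slices). [cite: KumarVolk2022, Theorem 10 (arXiv:2003.12938 p. 7); Blaser2013, Lemma 5.4] -/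
theorem overshoot_family (t k : ℕ) (ht : 2 ≤ t) (hk : 12 * t + 10 ≤ k) :
    ∃ F ∈ RV (Fin (k ^ t) × Fin (k ^ t)) (Fin (k ^ t) × Fin (k ^ t)) (Fin (k ^ t) × Fin (k ^ t)) (k ^ (2 * t + 1)),
      F ≠ 0 ∧ F.IsHomogeneous (k ^ (4 * t + 2)) ∧
        ∃ T : (Fin (k ^ t) × Fin (k ^ t)) → (Fin (k ^ t) × Fin (k ^ t)) → (Fin (k ^ t) × Fin (k ^ t)) → ℂ,
          tensorRank T ≤ k ^ (2 * t + 3) ∧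
            MvPolynomial.aeval (fun q : (Fin (k ^ t) × Fin (k ^ t)) × (Fin (k ^ t) × Fin (k ^ t)) × (Fin (k ^ t) × Fin (k ^ t)) =>
              T q.1 q.2.1 q.2.2) F ≠ 0 := by
  have hk1 : 1 ≤ k := by omega
  have hle : k ^ 3 ≤ k ^ t * k ^ t := by
    rw [← pow_add]; exact Nat.pow_le_pow_right hk1 (by omega)
  let ι : Fin (k ^ 3) → Fin (k ^ t) × Fin (k ^ t) := fun i => finProdFinEquiv.symm (Fin.castLE hle i)
  have hι : Function.Injective ι := finProdFinEquiv.symm.injective.comp (Fin.castLE_injective hle)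
  obtain ⟨F, hF, hF0, hhom, T, hT, hne⟩ :=
    exists_separating_of_subformat (β := Fin (k ^ t) × Fin (k ^ t)) (γ := Fin (k ^ t) × Fin (k ^ t)) hι
      (k ^ (2 * t + 1)) (k ^ (4 * t + 2)) (by
        have hc1 : Fintype.card ((Fin (k ^ (2 * t + 1)) × Fin (k ^ 3)) ⊕ ((Fin (k ^ (2 * t + 1)) × (Fin (k ^ t) × Fin (k ^ t))) ⊕
            (Fin (k ^ (2 * t + 1)) × (Fin (k ^ t) × Fin (k ^ t))))) =
            k ^ (2 * t + 1) * k ^ 3 + (k ^ (2 * t + 1) * (k ^ t * k ^ t) + k ^ (2 * t + 1) * (k ^ t * k ^ t)) := by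
          simp only [Fintype.card_sum, Fintype.card_prod, Fintype.card_fin]
        have hc2 : Fintype.card (Fin (k ^ 3) × (Fin (k ^ t) × Fin (k ^ t)) × (Fin (k ^ t) × Fin (k ^ t))) =
            k ^ 3 * ((k ^ t * k ^ t) * (k ^ t * k ^ t)) := by
          simp only [Fintype.card_prod, Fintype.card_fin]
        rw [hc1, hc2]
        exact room_family t k ht hk)
  refine ⟨F, hF, hF0, hhom, T, hT.trans (le_of_eq ?_), hne⟩
  simp only [Fintype.card_fin, Fintype.card_prod]
  rw [← pow_add, ← pow_add]; congr 1; omega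

/-- **Overshoot fails at row two** (the statement of the route aside `OvershootFailsRowTwo`, cell language of `E_corner`): for every
`δ > 0` there is `τ > 2` such that beyond every `n₀` there is a cell `n ≥ n₀`, `n² ≤ m`, `n^τ ≤ m` and an equation of
`σ_m((ℂ^{n×n})^{⊗3})`, homogeneous of degree `m²`, that is NON-ZERO at a tensor of rank `≤ n^{2+δ}`:
`I(σ_m)_{m²} ⊄ I(σ_{⌊n^{2+δ}⌋})`.  (Proof: `τ = 2 + 1/t` with `t ≥ max(2, 3/δ)`, cells `n = k^t`, `m = k^{2t+1}`.)
[cite: KumarVolk2022, Theorem 10 (arXiv:2003.12938 p. 7); Blaser2013, Lemma 5.4; LandsbergGCT2017, §8.3.4 (p. 227)] -/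
theorem overshoot_fails_rowTwo (δ : ℝ) (hδ : 0 < δ) :
    ∃ τ : ℝ, 2 < τ ∧ ∀ n₀ : ℕ, ∃ n m : ℕ, n₀ ≤ n ∧ n * n ≤ m ∧ (n : ℝ) ^ τ ≤ (m : ℝ) ∧
      ∃ f : MvPolynomial ((Fin n × Fin n) × (Fin n × Fin n) × (Fin n × Fin n)) ℂ,
        f.IsHomogeneous (m ^ 2) ∧
        (∀ t : (Fin n × Fin n) → (Fin n × Fin n) → (Fin n × Fin n) → ℂ, tensorRank t ≤ m →
          MvPolynomial.aeval (fun p : (Fin n × Fin n) × (Fin n × Fin n) × (Fin n × Fin n) => t p.1 p.2.1 p.2.2) f = 0) ∧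
        ∃ t : (Fin n × Fin n) → (Fin n × Fin n) → (Fin n × Fin n) → ℂ,
          (tensorRank t : ℝ) ≤ (n : ℝ) ^ (2 + δ) ∧
          MvPolynomial.aeval (fun p : (Fin n × Fin n) × (Fin n × Fin n) × (Fin n × Fin n) => t p.1 p.2.1 p.2.2) f ≠ 0 := by
  obtain ⟨t₀, ht₀⟩ := exists_nat_gt (3 / δ)
  set t : ℕ := max 2 t₀ with htdef
  have ht2 : 2 ≤ t := le_max_left _ _
  have htpos : (0 : ℝ) < t := by exact_mod_cast (lt_of_lt_of_le (by norm_num) ht2 : 0 < t)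
  have htδ : 3 ≤ (t : ℝ) * δ := by
    have h1 : (3 / δ : ℝ) < t := lt_of_lt_of_le ht₀ (by exact_mod_cast le_max_right 2 t₀)
    rw [div_lt_iff₀ hδ] at h1
    linarith
  have hτ : (2 : ℝ) < 2 + 1 / t := by
    have : (0 : ℝ) < 1 / t := by positivity
    linarith
  refine ⟨2 + 1 / t, hτ, fun n₀ => ?_⟩
  set k : ℕ := max (12 * t + 10) n₀ with hkdef
  have hk : 12 * t + 10 ≤ k := le_max_left _ _
  have hkn₀ : n₀ ≤ k := le_max_right _ _
  have hk1 : 1 ≤ k := by omega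
  obtain ⟨F, hF, _, hhom, T, hT, hne⟩ := overshoot_family t k ht2 hk
  refine ⟨k ^ t, k ^ (2 * t + 1), ?_, ?_, ?_, F, ?_, fun s hs => mem_RV.1 hF s hs, T, ?_, hne⟩
  · exact hkn₀.trans (Nat.le_self_pow (by omega) k)
  · rw [← pow_add]; exact Nat.pow_le_pow_right hk1 (by omega)
  · have hk0 : (0 : ℝ) ≤ k := Nat.cast_nonneg _
    have hexp : (t : ℝ) * (2 + 1 / t) = ((2 * t + 1 : ℕ) : ℝ) := by
      rw [mul_add, mul_one_div_cancel htpos.ne']; push_cast; ring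
    rw [Nat.cast_pow, ← Real.rpow_natCast_mul hk0, hexp, Real.rpow_natCast, Nat.cast_pow]
  · have hsq : (k ^ (2 * t + 1)) ^ 2 = k ^ (4 * t + 2) := by rw [← pow_mul]; congr 1; ring
    rw [hsq]; exact hhom
  · have hk1' : (1 : ℝ) ≤ k := by exact_mod_cast hk1
    have hk0 : (0 : ℝ) ≤ k := Nat.cast_nonneg _
    calc (tensorRank T : ℝ) ≤ ((k ^ (2 * t + 3) : ℕ) : ℝ) := by exact_mod_cast hT
      _ = (k : ℝ) ^ (((2 * t + 3 : ℕ) : ℝ)) := by rw [Real.rpow_natCast, Nat.cast_pow]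
      _ ≤ (k : ℝ) ^ ((t : ℝ) * (2 + δ)) := Real.rpow_le_rpow_of_exponent_le hk1' (by push_cast; nlinarith)
      _ = (((k ^ t : ℕ) : ℝ)) ^ (2 + δ) := by rw [Real.rpow_natCast_mul hk0, Nat.cast_pow]

end Corner

end Summit.MatrixMultiplication.MatrixMultiplication.Theorems.ObstructionDescentOvershoot

end
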